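import Literature.CategoryTheory.Preadditive.KrullSchmidtDecompositionExistence
import HarnessLib

/-!
# The Krull–Remak–Schmidt theorem in a preadditive category: uniqueness of finite biproduct decompositions into objects with
# local endomorphism rings (Krause, *Krull–Schmidt categories and projective covers*, Thm. 4.2; Shah §1, Def. 4.6)

Family `hodge`, lane `lit-hodgefound` (foundations library; seat `lit-hodgefound-p39`, generation 36, row g36-#15); topic
`CategoryTheory/Preadditive`, namespace `Literature.CategoryTheory.KrullSchmidt` (sequel of `IndecomposableLocalEnd` (g36-#13) and
`KrullSchmidtDecompositionExistence` (g36-#14)).  Third categorical step «towards Krull–Schmidt for motives»: the UNIQUENESS half.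
Krause proves Thm. 4.2 through projective covers over the semi-perfect ring `End(X)`; here the same reduction to the ring `End(X)` is
made through idempotents: a biproduct decomposition `X ≅ ⨁ⱼ Xⱼ` is a complete family of orthogonal idempotents `eⱼ` of `End(X)` with
corners `eⱼ End(X) eⱼ ≅ End(Xⱼ)` (g36-#14 `nonempty_end_ringEquiv_corner`), two such families with LOCAL corners are matched by a
bijection `σ` with `eⱼ ≅ e'_{σ j}` (isomorphic idempotents — Lam's Exercise 21.17, g36-#10 `exists_equiv_isIsoIdempotent_of_isLocalRing`,
itself the module Krull–Schmidt–Azumaya theorem g36-#2 applied to `_R R`, `R = End(X)`), and isomorphic idempotents `e = ab`, `e' = ba`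
give `Xⱼ ≅ Y_{σ j}`.  No idempotent-completeness and no chain condition is needed for uniqueness.

Sources, verbatim.  Krause [Krause2015KS]: **Theorem 4.2.** «Let `X` be an object of an additive category and suppose there are two
decompositions `X₁ ⊕ … ⊕ X_r = X = Y₁ ⊕ … ⊕ Y_s` into objects with local endomorphism rings. Then `r = s` and there exists a permutation
`π` such that `Xᵢ ≅ Y_{π(i)}` for `1 ≤ i ≤ r`.  Proof. Let `𝒜 = add X` and identify `𝒜` via `Hom_𝒜(X, −)` with a full subcategory of the
category of finitely generated projective modules over `End_𝒜(X)` … Thus we may assume that `X` is a finitely generated projective module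
over a semi-perfect ring.»  Shah [Shah2023KRS, §1]: «An object `X` is said to satisfy the Krull-Remak-Schmidt theorem if, whenever
`M₁ ⊕ ⋯ ⊕ M_m` and `N₁ ⊕ ⋯ ⊕ N_n` are finite direct sum decompositions of `X` into objects each having local endomorphism rings, then
`m = n` and there is a permutation `σ` in `Sym(n)` such that `Mⱼ` is isomorphic to `N_{σ(j)}` for `j = 1, …, n`.»  Def. 4.6: «Two
Krull-Remak-Schmidt decompositions … are said to be equivalent if `m = n` and there is a permutation `σ ∈ Sym(n)` such that
`Xⱼ ≅ Y_{σ(j)}`.»  Lam [Lam2001FirstCourse, §21 Ex. 21.17; Prop. (21.20)]: «`eR ≅ fR` … iff there exist `a, b ∈ R` such that `e = ab`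
and `f = ba`».

## What is formalised (`C` preadditive with finite biproducts; index types finite, in `Type` as in Mathlib's `biproduct.total`)

* §1 a biproduct decomposition `i : X ≅ ⨁ⱼ Xⱼ` yields the complete orthogonal idempotents
  `eⱼ = (X ≅ ⨁ X → Xⱼ → ⨁ X ≅ X)` of `End X` (`completeOrthogonalIdempotents_of_iso_biproduct`) whose corners are local iff the
  `End(Xⱼ)` are (`isLocalRing_corner_iff_of_iso_biproduct`).
* §2 **KRULL–REMAK–SCHMIDT UNIQUENESS (Krause Thm. 4.2)**: `X ≅ ⨁_{ι} Xⱼ ≅ ⨁_{κ} Yₖ` with all `End(Xⱼ)`, `End(Yₖ)` local ⟹ a bijection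
  `σ : ι ≃ κ` with `Xⱼ ≅ Y_{σ j}` (`exists_equiv_iso_of_iso_biproduct`); «`r = s`» (`card_eq_of_iso_biproduct`, `eq_of_iso_biproduct_fin`);
  with g36-#14: in an idempotent-complete preadditive category every object with artinian endomorphism ring «satisfies the
  Krull–Remak–Schmidt theorem» — existence and uniqueness (`krullRemakSchmidt`).

Theorems only, 0 `sorry`, no definition, no named fact (net debt 0, D-0026), no instance, no notation.

## Mathlib / Literature search

Mathlib: `biproduct.ι_π_self`/`ι_π_ne` (reassoc forms), `biproduct.total`, `Preadditive.comp_sum`/`sum_comp`, `End.of`/`End.asHom`;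
nothing on Krull–Schmidt in categories.  Literature: g36-#10 `exists_equiv_isIsoIdempotent_of_isLocalRing`, p08 `IsIsoIdempotent.exists_corner`
(normalised witnesses `a ∈ eRe'`, `b ∈ e'Re`), g36-#14 `isIdempotentElem_of_split`, `isLocalRing_end_iff_isLocalRing_corner_of_split`,
`exists_iso_biproduct_isLocalRing_end`.

## References

* H. Krause, *Krull–Schmidt categories and projective covers*, Expo. Math. 33 (2015), 535–549, arXiv:1410.2822: Thm. 4.2. [Krause2015KS]
* A. Shah, *Krull–Remak–Schmidt decompositions in Hom-finite additive categories*, Expo. Math. 41 (2023), 220–237: §1, Def. 4.6, Thm. 6.1.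
  [Shah2023KRS]
* T. Y. Lam, *A First Course in Noncommutative Rings*, 2nd ed., GTM 131, Springer (2001), §21 Prop. (21.20), Ex. 21.17. [Lam2001FirstCourse]
-/

open CategoryTheory CategoryTheory.Limits

namespace Literature.CategoryTheory.KrullSchmidt

universe v u

variable {C : Type u} [Category.{v} C] [Preadditive C] [HasFiniteBiproducts C]

/-! ## §1 The idempotents of a biproduct decomposition -/

section Projections

variable {X : C} {ι : Type} [Fintype ι] {Xs : ι → C} (i : X ≅ ⨁ Xs)

/-- The inclusion-then-projection of a biproduct decomposition splits: `(ιⱼ ≫ i⁻¹) ≫ (i ≫ πⱼ) = 𝟙`. [cite: Krause2015KS, §2 («`ι_X π_X = id_X`»)] -/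
theorem biproductIncl_comp_proj (j : ι) : (biproduct.ι Xs j ≫ i.inv) ≫ (i.hom ≫ biproduct.π Xs j) = 𝟙 (Xs j) := by
  simp only [Category.assoc, Iso.inv_hom_id_assoc, biproduct.ι_π_self]

/-- **A biproduct decomposition `X ≅ ⨁ⱼ Xⱼ` gives complete orthogonal idempotents `eⱼ = πⱼιⱼ` of `End X`** («`eⱼ ≔ iⱼpⱼ` … forms a
complete set of orthogonal idempotents of `Λ_X`»). [cite: Shah2023KRS, proof of Thm. 6.1] [cite: Krause2015KS, §2] -/
theorem completeOrthogonalIdempotents_of_iso_biproduct :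
    CompleteOrthogonalIdempotents fun j => End.of ((i.hom ≫ biproduct.π Xs j) ≫ (biproduct.ι Xs j ≫ i.inv)) := by
  refine ⟨⟨fun j => isIdempotentElem_of_split _ _ (biproductIncl_comp_proj i j), fun j k hjk => ?_⟩, ?_⟩
  · show ((i.hom ≫ biproduct.π Xs k) ≫ (biproduct.ι Xs k ≫ i.inv)) ≫ ((i.hom ≫ biproduct.π Xs j) ≫ (biproduct.ι Xs j ≫ i.inv)) = 0
    simp only [Category.assoc, Iso.inv_hom_id_assoc, biproduct.ι_π_ne_assoc Xs (Ne.symm hjk), zero_comp, comp_zero]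
  · show ∑ j, (i.hom ≫ biproduct.π Xs j) ≫ (biproduct.ι Xs j ≫ i.inv) = 𝟙 X
    have h : ∑ j, (i.hom ≫ biproduct.π Xs j) ≫ (biproduct.ι Xs j ≫ i.inv) = i.hom ≫ (∑ j, biproduct.π Xs j ≫ biproduct.ι Xs j) ≫ i.inv := by
      simp only [Preadditive.comp_sum, Preadditive.sum_comp, Category.assoc]
    rw [h, biproduct.total, Category.id_comp, Iso.hom_inv_id]

/-- The corner of `eⱼ` is local iff `End(Xⱼ)` is local (`eⱼ End(X) eⱼ ≅ End(Xⱼ)`, g36-#14). [cite: Krause2015KS, Thm. 4.2] [cite: Shah2023KRS, Thm. 6.1] -/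
theorem isLocalRing_corner_iff_of_iso_biproduct (j : ι) :
    IsLocalRing ((completeOrthogonalIdempotents_of_iso_biproduct i).idem j).Corner ↔ IsLocalRing (End (Xs j)) :=
  (isLocalRing_end_iff_isLocalRing_corner_of_split (biproduct.ι Xs j ≫ i.inv) (i.hom ≫ biproduct.π Xs j) (biproductIncl_comp_proj i j)
    rfl ((completeOrthogonalIdempotents_of_iso_biproduct i).idem j)).symm

end Projections

/-! ## §2 Krause Thm. 4.2: uniqueness of Krull–Remak–Schmidt decompositions -/

section Uniqueness

variable {X : C} {ι κ : Type} [Fintype ι] [Fintype κ] [DecidableEq ι] [DecidableEq κ] {Xs : ι → C} {Ys : κ → C}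

/-- **THE KRULL–REMAK–SCHMIDT THEOREM IN A PREADDITIVE CATEGORY (Krause Thm. 4.2).**  If `X ≅ ⨁ⱼ Xⱼ ≅ ⨁ₖ Yₖ` (finite families) with all
`End(Xⱼ)` and `End(Yₖ)` local, then there is a bijection `σ : ι ≃ κ` with `Xⱼ ≅ Y_{σ j}` for every `j`.  Proof: the two families of
projection idempotents of `End(X)` are complete, orthogonal, with local corners; by Lam's Ex. 21.17 (g36-#10) they are matched by a
bijection with `eⱼ ≅ e'_{σ j}`, i.e. `eⱼ = ab`, `e'_{σ j} = ba` with `a ∈ eⱼ R e'_{σ j}`, `b ∈ e'_{σ j} R eⱼ`; then `ιⱼ b π'_{σ j}` and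
`ι'_{σ j} a πⱼ` are mutually inverse. [cite: Krause2015KS, Thm. 4.2] [cite: Shah2023KRS, §1, Def. 4.6] [cite: Lam2001FirstCourse, §21 Ex. 21.17, Prop. (21.20)] -/
theorem exists_equiv_iso_of_iso_biproduct (i₁ : X ≅ ⨁ Xs) (i₂ : X ≅ ⨁ Ys) (h₁ : ∀ j, IsLocalRing (End (Xs j)))
    (h₂ : ∀ k, IsLocalRing (End (Ys k))) : ∃ σ : ι ≃ κ, ∀ j, Nonempty (Xs j ≅ Ys (σ j)) := by
  have he := completeOrthogonalIdempotents_of_iso_biproduct i₁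
  have he' := completeOrthogonalIdempotents_of_iso_biproduct i₂
  obtain ⟨σ, hσ⟩ := Literature.RingTheory.Idempotents.exists_equiv_isIsoIdempotent_of_isLocalRing he he'
    (fun j => (isLocalRing_corner_iff_of_iso_biproduct i₁ j).2 (h₁ j)) (fun k => (isLocalRing_corner_iff_of_iso_biproduct i₂ k).2 (h₂ k))
  refine ⟨σ, fun j => ?_⟩
  obtain ⟨a, b, hab, hba, -, haf, -, hbe⟩ := (hσ j).exists_corner (he.idem j) (he'.idem (σ j))
  -- in `End X` (`x * y = y ≫ x`): `ab = eⱼ` reads `b ≫ a = πⱼιⱼ`, `ba = e'` reads `a ≫ b = π'ι'`, `a e' = a` reads `e' ≫ a = a`, `b e = b` reads `e ≫ b = b`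
  have hab₀ : End.asHom b ≫ End.asHom a = (i₁.hom ≫ biproduct.π Xs j) ≫ (biproduct.ι Xs j ≫ i₁.inv) := hab
  have hba₀ : End.asHom a ≫ End.asHom b = (i₂.hom ≫ biproduct.π Ys (σ j)) ≫ (biproduct.ι Ys (σ j) ≫ i₂.inv) := hba
  have haf₀ : ((i₂.hom ≫ biproduct.π Ys (σ j)) ≫ (biproduct.ι Ys (σ j) ≫ i₂.inv)) ≫ End.asHom a = End.asHom a := haf
  have hbe₀ : ((i₁.hom ≫ biproduct.π Xs j) ≫ (biproduct.ι Xs j ≫ i₁.inv)) ≫ End.asHom b = End.asHom b := hbe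
  have hab' : End.asHom b ≫ End.asHom a = i₁.hom ≫ biproduct.π Xs j ≫ biproduct.ι Xs j ≫ i₁.inv := by
    simpa only [Category.assoc] using hab₀
  have hba' : End.asHom a ≫ End.asHom b = i₂.hom ≫ biproduct.π Ys (σ j) ≫ biproduct.ι Ys (σ j) ≫ i₂.inv := by
    simpa only [Category.assoc] using hba₀
  have haf' : i₂.hom ≫ biproduct.π Ys (σ j) ≫ biproduct.ι Ys (σ j) ≫ i₂.inv ≫ End.asHom a = End.asHom a := by
    simpa only [Category.assoc] using haf₀
  have hbe' : i₁.hom ≫ biproduct.π Xs j ≫ biproduct.ι Xs j ≫ i₁.inv ≫ End.asHom b = End.asHom b := by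
    simpa only [Category.assoc] using hbe₀
  refine ⟨⟨(biproduct.ι Xs j ≫ i₁.inv) ≫ End.asHom b ≫ (i₂.hom ≫ biproduct.π Ys (σ j)),
    (biproduct.ι Ys (σ j) ≫ i₂.inv) ≫ End.asHom a ≫ (i₁.hom ≫ biproduct.π Xs j), ?_, ?_⟩⟩
  · simp only [Category.assoc, reassoc_of% haf', reassoc_of% hab', Iso.inv_hom_id_assoc, biproduct.ι_π_self_assoc, biproduct.ι_π_self]
  · simp only [Category.assoc, reassoc_of% hbe', reassoc_of% hba', Iso.inv_hom_id_assoc, biproduct.ι_π_self_assoc, biproduct.ι_π_self]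

/-- **«Then `r = s`»**: the numbers of summands agree. [cite: Krause2015KS, Thm. 4.2] [cite: Shah2023KRS, §1] -/
theorem card_eq_of_iso_biproduct (i₁ : X ≅ ⨁ Xs) (i₂ : X ≅ ⨁ Ys) (h₁ : ∀ j, IsLocalRing (End (Xs j)))
    (h₂ : ∀ k, IsLocalRing (End (Ys k))) : Fintype.card ι = Fintype.card κ := by
  obtain ⟨σ, -⟩ := exists_equiv_iso_of_iso_biproduct i₁ i₂ h₁ h₂
  exact Fintype.card_congr σ

end Uniqueness

/-- `Fin`-indexed form: `X ≅ X₀ ⊞ ⋯ ⊞ X_{r-1} ≅ Y₀ ⊞ ⋯ ⊞ Y_{s-1}` with local endomorphism rings ⟹ `r = s` and `Xⱼ ≅ Y_{σ j}` for a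
permutation `σ`. [cite: Krause2015KS, Thm. 4.2] [cite: Shah2023KRS, §1, Def. 4.6] -/
theorem eq_of_iso_biproduct_fin {X : C} {r s : ℕ} {Xs : Fin r → C} {Ys : Fin s → C} (i₁ : X ≅ ⨁ Xs) (i₂ : X ≅ ⨁ Ys)
    (h₁ : ∀ j, IsLocalRing (End (Xs j))) (h₂ : ∀ k, IsLocalRing (End (Ys k))) :
    r = s ∧ ∃ σ : Fin r ≃ Fin s, ∀ j, Nonempty (Xs j ≅ Ys (σ j)) := by
  obtain ⟨σ, hσ⟩ := exists_equiv_iso_of_iso_biproduct i₁ i₂ h₁ h₂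
  exact ⟨by simpa using Fintype.card_congr σ, σ, hσ⟩

/-- **Every object with artinian endomorphism ring in an idempotent-complete preadditive category «satisfies the Krull–Remak–Schmidt
theorem»: it HAS a finite biproduct decomposition into objects with local endomorphism rings (g36-#14), and any two such
decompositions are equivalent.** [cite: Shah2023KRS, §1, Thm. 6.1] [cite: Krause2015KS, Thm. 4.2, §4] -/
theorem krullRemakSchmidt [HasBinaryBiproducts C] [IsIdempotentComplete C] (X : C) [IsArtinianRing (End X)] :
    (∃ (n : ℕ) (Y : Fin n → C), Nonempty (X ≅ ⨁ Y) ∧ ∀ j, Indecomposable (Y j) ∧ IsLocalRing (End (Y j))) ∧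
      ∀ {r s : ℕ} {Xs : Fin r → C} {Ys : Fin s → C}, Nonempty (X ≅ ⨁ Xs) → Nonempty (X ≅ ⨁ Ys) →
        (∀ j, IsLocalRing (End (Xs j))) → (∀ k, IsLocalRing (End (Ys k))) →
          r = s ∧ ∃ σ : Fin r ≃ Fin s, ∀ j, Nonempty (Xs j ≅ Ys (σ j)) :=
  ⟨exists_iso_biproduct_indecomposable X, fun ⟨i₁⟩ ⟨i₂⟩ h₁ h₂ => eq_of_iso_biproduct_fin i₁ i₂ h₁ h₂⟩

end Literature.CategoryTheory.KrullSchmidt
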